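import Literature.RepresentationTheory.CompactGroups.MatrixGroupExpSurjective
import Literature.AlgebraicTopology.Homotopy.ManifoldStronglyLocallyContractible
import Mathlib.Topology.Homotopy.LocallyContractible
import HarnessLib

/-!
# Closed unitary matrix groups are strongly locally contractible

Topic `Literature/RepresentationTheory/CompactGroups`, a topological complement to von Neumann's
closed-subgroup theorem of `MatrixGroupExpSurjective.lean` (`MatrixLie.exists_chart`: a closed
unitary matrix group `S ⊆ M_n(ℂ)` is, near `1`, the homeomorphic image under `exp` of an open
subset of its Lie algebra `L(S)`, with inverse the matrix logarithm `mlog`).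

* `MatrixLie.IsClosedUnitaryGroup.exists_isOpenEmbedding_nhds_one` — an open neighbourhood of
  `1` in `S` embeds openly (by `mlog`) into the real vector space `L(S)` (Bröcker–tom Dieck 1985,
  I (3.11): "`S` is locally `exp L(S)`", i.e. `S` is a submanifold of `M_n(ℂ)` modelled on `L(S)`);
* `MatrixLie.IsClosedUnitaryGroup.stronglyLocallyContractibleSpace` — hence (left translations
  are homeomorphisms of `S`; open subsets of real normed spaces are strongly locally contractible,
  Hatcher 2002, proof of Cor. A.9: "Manifolds are locally contractible"; strong local
  contractibility is local, `StronglyLocallyContractibleSpace.of_isOpen_cover`) `S` is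
  STRONGLY LOCALLY CONTRACTIBLE in Mathlib's sense (contractible neighbourhoods form a basis),
  therefore locally path connected (`…locallyPathConnectedSpace`) and, when connected, path
  connected (`…pathConnectedSpace`);
* `MatrixLie.stronglyLocallyContractibleSpace_of_faithful` — the abstract corollary: a compact
  topological group with a faithful continuous finite-dimensional complex representation is
  strongly locally contractible (unitarise by Weyl's trick, `CompactGroup.unitarize`; the group is
  then homeomorphic — a continuous injection from a compact space into a Hausdorff space is a
  closed embedding — to its image, a closed unitary matrix group), with the same two corollaries
  (`…locallyPathConnectedSpace_of_faithful`, `…pathConnectedSpace_of_faithful`).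

These are exactly the point-set hypotheses (`PathConnectedSpace`, `StronglyLocallyContractibleSpace`)
under which the universal covering group of `Literature/Topology/CoveringSpaces/UniversalCover*.lean`
is a covering group, so they make that construction available for compact (Lie =) linear groups.
Everything is a `theorem`; no definition and no named fact is introduced.

## References

* T. Bröcker, T. tom Dieck, *Representations of Compact Lie Groups*, GTM 98, Springer (1985),
  I (3.11). [BrockerTomDieck1985]
* A. Hatcher, *Algebraic Topology*, CUP (2002), Appendix, proof of Cor. A.9. [HatcherAT2002]
-/

set_option autoImplicit false

noncomputable section

open scoped Matrix.Norms.Operator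
open NormedSpace Matrix Set
open _root_.Topology

namespace Literature.RepresentationTheory.CompactGroups

namespace MatrixLie

variable {ι : Type*} [Fintype ι] [DecidableEq ι] {S : Set (Matrix ι ι ℂ)}

namespace IsClosedUnitaryGroup

/-- **A closed unitary matrix group is locally modelled on its Lie algebra.** There is an open
neighbourhood `U` of `1` in `S` and an open embedding `U → L(S)` (namely the matrix logarithm
`mlog`, with inverse `exp`): von Neumann's theorem `exists_chart` says `mlog` maps the elements of
`S` near `1` into `L(S)` with `exp ∘ mlog = id` there, and `mlog` is the local inverse of `exp`
given by the inverse function theorem, a homeomorphism between open neighbourhoods of `1` and `0`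
in `M_n(ℂ)`. [cite: BrockerTomDieck1985, I (3.11)] -/
theorem exists_isOpenEmbedding_nhds_one (hS : IsClosedUnitaryGroup S) :
    ∃ U : Set ↥S, IsOpen U ∧ (⟨1, hS.one_mem⟩ : ↥S) ∈ U ∧
      ∃ f : ↥U → ↥(lieAlg hS), IsOpenEmbedding f := by
  -- the local inverse of `exp` at `0` as an open partial homeomorphism `e`, `e.symm = mlog`
  set e := (hasStrictFDerivAt_exp_zero_equiv (ι := ι)).toOpenPartialHomeomorph exp with he_def
  have he : (e : Matrix ι ι ℂ → Matrix ι ι ℂ) = exp :=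
    HasStrictFDerivAt.toOpenPartialHomeomorph_coe _
  have hmlog : (mlog : Matrix ι ι ℂ → Matrix ι ι ℂ) = e.symm := rfl
  have h1 : (1 : Matrix ι ι ℂ) ∈ e.target := by
    have h := (hasStrictFDerivAt_exp_zero_equiv (ι := ι)).image_mem_toOpenPartialHomeomorph_target
    rwa [exp_zero] at h
  obtain ⟨ε, hε, hchart⟩ := exists_chart hS
  -- the chart domain `U = {h ∈ S | dist h 1 < ε, h ∈ e.target}` and its image `T ⊆ L(S)`
  refine ⟨{h | dist (h : Matrix ι ι ℂ) 1 < ε ∧ (h : Matrix ι ι ℂ) ∈ e.target}, ?_, ?_, ?_⟩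
  · exact (Metric.isOpen_ball.preimage continuous_subtype_val).inter
      (e.open_target.preimage continuous_subtype_val)
  · exact ⟨by simp [hε], h1⟩
  set U : Set ↥S := {h | dist (h : Matrix ι ι ℂ) 1 < ε ∧ (h : Matrix ι ι ℂ) ∈ e.target} with hU
  set T : Set ↥(lieAlg hS) := {X | (X : Matrix ι ι ℂ) ∈ e.source ∧
    dist (exp (X : Matrix ι ι ℂ)) 1 < ε ∧ exp (X : Matrix ι ι ℂ) ∈ e.target} with hT
  have hTo : IsOpen T := by
    refine (e.open_source.preimage continuous_subtype_val).inter
      ((Metric.isOpen_ball.preimage (exp_continuous.comp continuous_subtype_val)).inter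
        (e.open_target.preimage (exp_continuous.comp continuous_subtype_val)))
  have hmemL : ∀ h : ↥U, mlog ((h : ↥S) : Matrix ι ι ℂ) ∈ lieAlg hS := fun h =>
    (hchart _ h.1.2 h.2.1).1
  have hexp : ∀ h : ↥U, exp (mlog ((h : ↥S) : Matrix ι ι ℂ)) = h := fun h =>
    (hchart _ h.1.2 h.2.1).2
  have hmemT : ∀ h : ↥U, (⟨mlog ((h : ↥S) : Matrix ι ι ℂ), hmemL h⟩ : ↥(lieAlg hS)) ∈ T := by
    intro h
    refine ⟨?_, ?_, ?_⟩
    · show mlog ((h : ↥S) : Matrix ι ι ℂ) ∈ e.source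
      rw [hmlog]
      exact e.map_target h.2.2
    · show dist (exp (mlog ((h : ↥S) : Matrix ι ι ℂ))) 1 < ε
      rw [hexp h]
      exact h.2.1
    · show exp (mlog ((h : ↥S) : Matrix ι ι ℂ)) ∈ e.target
      rw [hexp h]
      exact h.2.2
  have hmemU : ∀ X : ↥T,
      (⟨exp ((X : ↥(lieAlg hS)) : Matrix ι ι ℂ), exp_mem_of_mem_lieSet X.1.2⟩ : ↥S) ∈ U := fun X =>
    ⟨X.2.2.1, X.2.2.2⟩
  have hφc : Continuous fun h : ↥U =>
      (⟨⟨mlog ((h : ↥S) : Matrix ι ι ℂ), hmemL h⟩, hmemT h⟩ : ↥T) := by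
    refine Continuous.subtype_mk (Continuous.subtype_mk ?_ _) _
    rw [hmlog]
    exact e.continuousOn_symm.comp_continuous
      (continuous_subtype_val.comp continuous_subtype_val) fun h => h.2.2
  have hψc : Continuous fun X : ↥T =>
      (⟨⟨exp ((X : ↥(lieAlg hS)) : Matrix ι ι ℂ), exp_mem_of_mem_lieSet X.1.2⟩, hmemU X⟩ : ↥U) := by
    refine Continuous.subtype_mk (Continuous.subtype_mk ?_ _) _
    exact exp_continuous.comp (continuous_subtype_val.comp continuous_subtype_val)
  let φ : ↥U ≃ₜ ↥T :=
    { toFun := fun h => ⟨⟨mlog ((h : ↥S) : Matrix ι ι ℂ), hmemL h⟩, hmemT h⟩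
      invFun := fun X =>
        ⟨⟨exp ((X : ↥(lieAlg hS)) : Matrix ι ι ℂ), exp_mem_of_mem_lieSet X.1.2⟩, hmemU X⟩
      left_inv := fun h => Subtype.ext (Subtype.ext (hexp h))
      right_inv := fun X => Subtype.ext (Subtype.ext (by
        show mlog (exp ((X : ↥(lieAlg hS)) : Matrix ι ι ℂ)) = X
        rw [hmlog, ← he]
        exact e.left_inv X.2.1))
      continuous_toFun := hφc
      continuous_invFun := hψc }
  exact ⟨Subtype.val ∘ φ, hTo.isOpenEmbedding_subtypeVal.comp φ.isOpenEmbedding⟩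

/-- **Closed unitary matrix groups are strongly locally contractible** (contractible
neighbourhoods form a basis at every point): near `1` the group `S` is homeomorphic to an open
subset of the real vector space `L(S)` (`exists_isOpenEmbedding_nhds_one`), real normed spaces are
strongly locally contractible and the property passes along open embeddings, and the left
translations `h ↦ g h` are homeomorphisms of `S` moving `1` to any `g ∈ S` ("Manifolds are
locally contractible", Hatcher 2002, proof of Cor. A.9, for the manifold `S` of Bröcker–tom Dieck
I (3.11)). [cite: HatcherAT2002, Cor. A.9 (proof)] -/
theorem stronglyLocallyContractibleSpace (hS : IsClosedUnitaryGroup S) :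
    StronglyLocallyContractibleSpace ↥S := by
  obtain ⟨U, hUo, h1U, f, hf⟩ := exists_isOpenEmbedding_nhds_one hS
  -- the normed-space topology of `L(S)` is (definitionally, but not reducibly) its subspace
  -- topology: state the instance at the subspace topology before registering it
  haveI : StronglyLocallyContractibleSpace ↥(lieAlg hS) :=
    Literature.AlgebraicTopology.Homotopy.stronglyLocallyContractibleSpace_of_normedSpace ↥(lieAlg hS)
  haveI : StronglyLocallyContractibleSpace ↥U := hf.stronglyLocallyContractibleSpace
  refine StronglyLocallyContractibleSpace.of_isOpen_cover fun g => ?_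
  -- left translation by `g`, a homeomorphism of `S`
  let L : ↥S ≃ₜ ↥S :=
    { toFun := fun h => ⟨(g : Matrix ι ι ℂ) * h, hS.mul_mem g.2 h.2⟩
      invFun := fun h => ⟨(g : Matrix ι ι ℂ)ᴴ * h, hS.mul_mem (hS.star_mem g.2) h.2⟩
      left_inv := fun h => Subtype.ext (by
        show (g : Matrix ι ι ℂ)ᴴ * ((g : Matrix ι ι ℂ) * h) = h
        rw [← Matrix.mul_assoc, hS.star_mul_self g.2, Matrix.one_mul])
      right_inv := fun h => Subtype.ext (by
        show (g : Matrix ι ι ℂ) * ((g : Matrix ι ι ℂ)ᴴ * h) = h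
        rw [← Matrix.mul_assoc, hS.mul_star_self g.2, Matrix.one_mul])
      continuous_toFun := (continuous_const.mul continuous_subtype_val).subtype_mk _
      continuous_invFun := (continuous_const.mul continuous_subtype_val).subtype_mk _ }
  refine ⟨L '' U, L.isOpenMap U hUo, ⟨⟨1, hS.one_mem⟩, h1U, Subtype.ext (Matrix.mul_one _)⟩, ?_⟩
  exact (L.image U).symm.isOpenEmbedding.stronglyLocallyContractibleSpace

/-- Closed unitary matrix groups are locally path connected (they are strongly locally
contractible). [folklore] -/
theorem locallyPathConnectedSpace (hS : IsClosedUnitaryGroup S) : LocallyPathConnectedSpace ↥S := by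
  haveI := hS.stronglyLocallyContractibleSpace
  infer_instance

/-- A connected closed unitary matrix group is path connected (locally path connected and
connected). [folklore] -/
theorem pathConnectedSpace (hS : IsClosedUnitaryGroup S) (hconn : IsPreconnected S) :
    PathConnectedSpace ↥S := by
  haveI := hS.locallyPathConnectedSpace
  haveI : ConnectedSpace ↥S := isConnected_iff_connectedSpace.1 ⟨hS.nonempty, hconn⟩
  exact PathConnectedSpace.of_locallyPathConnectedSpace

end IsClosedUnitaryGroup

/-! ### The abstract corollary: compact groups with a faithful representation -/

section Abstract

open Literature.RepresentationTheory.CompactGroups.CompactGroup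

variable {G : Type*} [Group G] [TopologicalSpace G] [IsTopologicalGroup G] [CompactSpace G]
variable {n : Type*} [Fintype n] [DecidableEq n]

/-- **A compact group with a faithful continuous finite-dimensional representation is
homeomorphic to a closed unitary matrix group**: unitarise the representation (Weyl's trick,
`CompactGroup.unitarize`, conjugation by an invertible matrix, so still faithful); its image is a
closed unitary matrix group and the corestriction is a homeomorphism (a continuous injection from a
compact space into a Hausdorff space is a closed embedding). [folklore] -/
theorem exists_homeomorph_isClosedUnitaryGroup (ρ : G →* Matrix n n ℂ) (hρ : Continuous ρ)
    (hinj : Function.Injective ρ) :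
    ∃ S : Set (Matrix n n ℂ), IsClosedUnitaryGroup S ∧ Nonempty (G ≃ₜ ↥S) := by
  classical
  set σ := unitarize ρ hρ with hσ
  have hσc : Continuous σ := continuous_unitarize ρ hρ
  have hB := isUnit_det_unitarizer ρ hρ
  have hσinj : Function.Injective σ := by
    intro a b h
    apply hinj
    have key : ∀ g, ρ g = (unitarizer ρ hρ)⁻¹ * σ g * unitarizer ρ hρ := fun g => by
      rw [hσ, unitarize_apply, show (unitarizer ρ hρ)⁻¹ * (unitarizer ρ hρ * ρ g * (unitarizer ρ hρ)⁻¹) *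
          unitarizer ρ hρ = ((unitarizer ρ hρ)⁻¹ * unitarizer ρ hρ) * ρ g *
          ((unitarizer ρ hρ)⁻¹ * unitarizer ρ hρ) by simp only [Matrix.mul_assoc],
        Matrix.nonsing_inv_mul _ hB, Matrix.one_mul, Matrix.mul_one]
    rw [key a, key b, h]
  refine ⟨Set.range σ, ?_, ⟨(hσc.isClosedEmbedding hσinj).isEmbedding.toHomeomorph⟩⟩
  exact
    { one_mem := ⟨1, map_one σ⟩
      mul_mem := by rintro _ _ ⟨a, rfl⟩ ⟨b, rfl⟩; exact ⟨a * b, map_mul σ a b⟩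
      star_mem := by
        rintro _ ⟨a, rfl⟩
        refine ⟨a⁻¹, ?_⟩
        rw [hσ, unitarize_inv, Matrix.star_eq_conjTranspose]
      mem_unitary := by rintro _ ⟨a, rfl⟩; exact unitarize_mem_unitaryGroup ρ hρ a
      isClosed := (isCompact_range hσc).isClosed }

/-- **A compact topological group with a faithful continuous finite-dimensional complex
representation is strongly locally contractible** (it is homeomorphic to a closed unitary matrix
group, `exists_homeomorph_isClosedUnitaryGroup`, which is strongly locally contractible,
`IsClosedUnitaryGroup.stronglyLocallyContractibleSpace`; compact linear groups are compact Lie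
groups, Bröcker–tom Dieck I (3.11), and manifolds are locally contractible, Hatcher Cor. A.9).
[cite: HatcherAT2002, Cor. A.9 (proof)] -/
theorem stronglyLocallyContractibleSpace_of_faithful (ρ : G →* Matrix n n ℂ) (hρ : Continuous ρ)
    (hinj : Function.Injective ρ) : StronglyLocallyContractibleSpace G := by
  obtain ⟨S, hS, ⟨e⟩⟩ := exists_homeomorph_isClosedUnitaryGroup ρ hρ hinj
  haveI := hS.stronglyLocallyContractibleSpace
  exact e.isOpenEmbedding.stronglyLocallyContractibleSpace

/-- A compact topological group with a faithful continuous finite-dimensional complex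
representation is locally path connected. [folklore] -/
theorem locallyPathConnectedSpace_of_faithful (ρ : G →* Matrix n n ℂ) (hρ : Continuous ρ)
    (hinj : Function.Injective ρ) : LocallyPathConnectedSpace G := by
  haveI := stronglyLocallyContractibleSpace_of_faithful ρ hρ hinj
  infer_instance

/-- A compact connected topological group with a faithful continuous finite-dimensional complex
representation is path connected. [folklore] -/
theorem pathConnectedSpace_of_faithful [ConnectedSpace G] (ρ : G →* Matrix n n ℂ)
    (hρ : Continuous ρ) (hinj : Function.Injective ρ) : PathConnectedSpace G := by
  haveI := locallyPathConnectedSpace_of_faithful ρ hρ hinj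
  exact PathConnectedSpace.of_locallyPathConnectedSpace

end Abstract

end MatrixLie

end Literature.RepresentationTheory.CompactGroups
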